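import Summits.CriticalPhenomena.PercolationContinuityZ3.Theorems.PercNearOneGluingNoHeavyLowerTailKnQuestion8CoefficientwiseComponentFlipGeneral
import HarnessLib

/-!
# The ATTACHMENT FLIP: recolouring the edges at a vertex set `W` whose neighbours in the zone are core vertices that stay core without `W`

Support file (`--supports stmt-CriticalPhenomena-4575`, closed), prover `prim-lf-2` (gen 35).  No definitions, no named facts, no sorries; standard axioms.
Memo `prim-lf-2/CW-INVOLUTION-gen35.md` §1; notation of `prim-lf-2/CW-PROGRAMME-gen21.md`.

Setting (as in prim-cplus-coupling's `…CoefficientwiseComponentFlipGeneral`, root written `z`): finite multigraph `ends : ι → Sym2 V`, edge set `E₀`,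
colouring `s ⊆ E₀` (red) / `E₀ \ s` (blue), `C_v(s) = openCluster (ends '' s) v`, zone `U = C_z(s) ∪ C_z(E₀ \ s)`, core `D = C_z(s) ∩ C_z(E₀ \ s)`.
For `W ⊆ U \ {z}` let `I` be the set of `E₀`-edges meeting `W`.  prim-cplus-coupling's GENERAL FLIP LEMMA (`mem_openCluster_flip_iff_general`) computes the
two clusters of `z` after the recolouring `s ↦ s ∆ I` when `W` is closed under the `E₀`-edges inside `U \ {z}` (a union of components of `U \ {z}`: its only
zone-neighbour outside `W` is `z`).  This file weakens that hypothesis to an ATTACHMENT condition: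
* `Coefficientwise.mem_openCluster_flip_iff_attach` — if every zone vertex `w' ∉ W ∪ {z}` joined to `W` by an `E₀`-edge is reachable from `z` by a red path
  AND by a blue path using no edge of `I` (i.e. `w' ∈ C_z(s \ I) ∩ C_z((E₀ \ s) \ I)`: a core vertex that stays a core vertex when `W` is deleted), then
  `C_z(s ∆ I) = {z} ∪ (C_z(s) \ W) ∪ (W ∩ C_z(E₀ \ s))` — inside `W` the two clusters of `z` are exchanged, outside `W` nothing changes;
* `Coefficientwise.mem_openCluster_sdiff_flip_iff_attach` — the same for the blue cluster `C_z(E₀ \ (s ∆ I))`;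
* `Coefficientwise.union_flip_eq_attach`, `Coefficientwise.inter_flip_eq_attach` — hence the zone AND the core are invariant (so the wall `x ∉ U`, the
  components of `U \ D`, the attachment condition itself and every weight depending on `(U, D)` are preserved, and `s ↦ s ∆ I` is an involution on the
  colourings for which a fixed `W` satisfies the condition).
The general flip lemma is the special case in which the attachment hypothesis is vacuous.  Use (memo §1–2): for the POINT ROW `Σ_W σ_u σ_w ≥ 0` of CW-PA,
flipping the minimal admissible `W ⊇` (lobe of `w`) not containing `u` pairs crossing and concordant colourings exactly; the point row reduces to the
'entangled' colourings where no admissible `W` separates `w` from `u` (census: 15 % of the crossing colourings at 6 vertices).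
Proofs: the closed-set principle `openCluster_subset_of_closed` (…CoefficientwiseTrivialCoreFlip) in each direction, as in the general flip lemma, with the
attachment hypothesis replacing closedness at the boundary of `W`.
[cite: KozmaNitzan2024, Questions 8–9 (§5.5 p. 36) (context: the Question-8 pocket covariance programme)]
-/

namespace Summit.CriticalPhenomena.PercolationContinuityZ3.Theorems

open Finset Literature.Probability.Percolation
open scoped symmDiff

namespace Coefficientwise

variable {ι V : Type*}

open Classical in
/-- **Attachment flip lemma.**  `s ⊆ E₀`; `W` a set of zone vertices other than `z`; `I` the edges of `E₀` meeting `W`.  If every zone vertex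
`w' ∉ W ∪ {z}` joined to `W` by an `E₀`-edge lies in `C_z(s \ I) ∩ C_z((E₀ \ s) \ I)` (red- and blue-reachable from `z` without the edges at `W`), then
`y ∈ C_z(s ∆ I) ↔ y = z ∨ (y ∈ C_z(s) ∧ y ∉ W) ∨ (y ∈ W ∧ y ∈ C_z(E₀ \ s))`. [cite: KozmaNitzan2024, §5.5 (context only; folklore)] -/
theorem mem_openCluster_flip_iff_attach (ends : ι → Sym2 V) {E₀ s : Finset ι} {z : V} (hs : s ⊆ E₀) (W : Set V)
    (hWU : ∀ w ∈ W, (w ∈ openCluster (ends '' (↑s : Set ι)) z ∨ w ∈ openCluster (ends '' (↑(E₀ \ s) : Set ι)) z) ∧ w ≠ z)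
    (hWa : ∀ w ∈ W, ∀ i ∈ E₀, ∀ w', ends i = s(w, w') →
      (w' ∈ openCluster (ends '' (↑s : Set ι)) z ∨ w' ∈ openCluster (ends '' (↑(E₀ \ s) : Set ι)) z) → w' ≠ z → w' ∉ W →
        w' ∈ openCluster (ends '' (↑(s \ E₀.filter (fun i => ∃ w, w ∈ W ∧ w ∈ ends i)) : Set ι)) z ∧
        w' ∈ openCluster (ends '' (↑((E₀ \ s) \ E₀.filter (fun i => ∃ w, w ∈ W ∧ w ∈ ends i)) : Set ι)) z)
    (y : V) :
    y ∈ openCluster (ends '' (↑(s ∆ (E₀.filter (fun i => ∃ w, w ∈ W ∧ w ∈ ends i))) : Set ι)) z ↔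
      y = z ∨ (y ∈ openCluster (ends '' (↑s : Set ι)) z ∧ y ∉ W) ∨ (y ∈ W ∧ y ∈ openCluster (ends '' (↑(E₀ \ s) : Set ι)) z) := by
  set A : Set V := openCluster (ends '' (↑s : Set ι)) z with hA
  set B : Set V := openCluster (ends '' (↑(E₀ \ s) : Set ι)) z with hB
  set I : Finset ι := E₀.filter (fun i => ∃ w, w ∈ W ∧ w ∈ ends i) with hI
  have memI : ∀ {i : ι}, i ∈ I ↔ i ∈ E₀ ∧ ∃ w, w ∈ W ∧ w ∈ ends i := fun {i} => by rw [hI, Finset.mem_filter]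
  have hzW : z ∉ W := fun h => (hWU z h).2 rfl
  -- the two restricted clusters are sub-clusters of `A`, `B` and of the flipped red cluster
  have hAI : openCluster (ends '' (↑(s \ I) : Set ι)) z ⊆ A := openCluster_image_mono ends Finset.sdiff_subset z
  have hBI : openCluster (ends '' (↑((E₀ \ s) \ I) : Set ι)) z ⊆ B := openCluster_image_mono ends Finset.sdiff_subset z
  have hsI : s \ I ⊆ s ∆ I := by
    intro i hi
    rw [Finset.mem_sdiff] at hi
    exact Finset.mem_symmDiff.mpr (Or.inl hi)
  have hAI' : openCluster (ends '' (↑(s \ I) : Set ι)) z ⊆ openCluster (ends '' (↑(s ∆ I) : Set ι)) z :=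
    openCluster_image_mono ends hsI z
  constructor
  · -- `⊆`: the right-hand side contains `z` and is closed under the edges of `s ∆ I`
    intro hy
    have key : openCluster (ends '' (↑(s ∆ I) : Set ι)) z ⊆ {v | v = z ∨ (v ∈ A ∧ v ∉ W) ∨ (v ∈ W ∧ v ∈ B)} := by
      refine openCluster_subset_of_closed ends (s ∆ I) z (Or.inl rfl) ?_
      intro i hi a b he ha
      have hbi : b ∈ ends i := by rw [he]; exact Sym2.mem_mk_right a b
      have hai : a ∈ ends i := by rw [he]; exact Sym2.mem_mk_left a b
      rcases Finset.mem_symmDiff.mp hi with ⟨his, hiI⟩ | ⟨hiI, hins⟩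
      · -- red edge not meeting `W`
        have haW : a ∉ W := fun h => hiI (memI.mpr ⟨hs his, a, h, hai⟩)
        have hbW : b ∉ W := fun h => hiI (memI.mpr ⟨hs his, b, h, hbi⟩)
        have haA : a ∈ A := by
          rcases ha with rfl | ⟨haA, -⟩ | ⟨haW', -⟩
          · exact mem_openCluster_self _ _
          · exact haA
          · exact absurd haW' haW
        exact Or.inr (Or.inl ⟨mem_openCluster_of_edge ends his he haA, hbW⟩)
      · -- blue edge meeting `W`
        obtain ⟨hiE, w, hwW, hwi⟩ := memI.mp hiI
        have hib : i ∈ E₀ \ s := Finset.mem_sdiff.mpr ⟨hiE, hins⟩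
        rcases ha with rfl | ⟨haA, haW⟩ | ⟨haW, haB⟩
        · -- `a = z`: the `W`-end is `b`, which is blue-adjacent to `z`
          have hwb : w = b := by
            rw [he, Sym2.mem_iff] at hwi
            rcases hwi with rfl | rfl
            · exact absurd hwW hzW
            · rfl
          subst hwb
          exact Or.inr (Or.inr ⟨hwW, mem_openCluster_of_edge ends hib he (mem_openCluster_self _ _)⟩)
        · -- `a ∈ A \ W`: then `w = b ∈ W`; unless `a = z`, the attachment hypothesis makes `a` blue-reachable, hence `b ∈ B`
          by_cases haz : a = z
          · subst haz
            have hwb : w = b := by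
              rw [he, Sym2.mem_iff] at hwi
              rcases hwi with rfl | rfl
              · exact absurd hwW hzW
              · rfl
            subst hwb
            exact Or.inr (Or.inr ⟨hwW, mem_openCluster_of_edge ends hib he (mem_openCluster_self _ _)⟩)
          · have hwb : w = b := by
              rw [he, Sym2.mem_iff] at hwi
              rcases hwi with rfl | rfl
              · exact absurd hwW haW
              · rfl
            subst hwb
            have haB : a ∈ B := hBI (hWa w hwW i hiE a (he.trans Sym2.eq_swap) (Or.inl haA) haz haW).2
            exact Or.inr (Or.inr ⟨hwW, mem_openCluster_of_edge ends hib he haB⟩)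
        · -- `a ∈ W ∩ B`: `b` is blue-adjacent to `a`, so `b ∈ B`; `b ∈ W`, or `b = z`, or `b` is an attachment vertex (then `b ∈ A`)
          have hbB : b ∈ B := mem_openCluster_of_edge ends hib he haB
          by_cases hbW : b ∈ W
          · exact Or.inr (Or.inr ⟨hbW, hbB⟩)
          · by_cases hbz : b = z
            · exact Or.inl hbz
            · exact Or.inr (Or.inl ⟨hAI (hWa a haW i hiE b he (Or.inr hbB) hbz hbW).1, hbW⟩)
    exact key hy
  · -- `⊇`
    rintro (rfl | ⟨hyA, hyW⟩ | ⟨hyW, hyB⟩)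
    · exact mem_openCluster_self _ _
    · -- every vertex of `A` outside `W` is red-reachable without the edges at `W`
      have hsub : A ⊆ {v | v ∈ A ∧ (v ∉ W → v ∈ openCluster (ends '' (↑(s \ I) : Set ι)) z)} := by
        refine openCluster_subset_of_closed ends s z ⟨mem_openCluster_self _ _, fun _ => mem_openCluster_self _ _⟩ ?_
        intro i hi a b he ha
        obtain ⟨haA, haI⟩ := ha
        have hbi : b ∈ ends i := by rw [he]; exact Sym2.mem_mk_right a b
        have hai : a ∈ ends i := by rw [he]; exact Sym2.mem_mk_left a b
        have hbA : b ∈ A := mem_openCluster_of_edge ends hi he haA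
        refine ⟨hbA, fun hbW => ?_⟩
        by_cases haW : a ∈ W
        · -- `b` is joined to `W`: `b = z` or an attachment vertex
          by_cases hbz : b = z
          · subst hbz; exact mem_openCluster_self _ _
          · exact (hWa a haW i (hs hi) b he (Or.inl hbA) hbz hbW).1
        · -- the edge avoids `W`
          have hiI : i ∉ I := by
            intro hiI
            obtain ⟨-, w, hwW, hwi⟩ := memI.mp hiI
            rw [he, Sym2.mem_iff] at hwi
            rcases hwi with rfl | rfl
            · exact haW hwW
            · exact hbW hwW
          exact mem_openCluster_of_edge ends (Finset.mem_sdiff.mpr ⟨hi, hiI⟩) he (haI haW)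
      exact hAI' ((hsub hyA).2 hyW)
    · -- every vertex of `B` inside `W` becomes red-reachable: enter `W` from `z` or from an attachment vertex (red-reachable without `I`),
      -- then follow the blue edges at `W`, which are red after the flip
      have hsub : B ⊆ {v | v ∈ B ∧ (v ∉ W → v ∈ openCluster (ends '' (↑((E₀ \ s) \ I) : Set ι)) z) ∧
          (v ∈ W → v ∈ openCluster (ends '' (↑(s ∆ I) : Set ι)) z)} := by
        refine openCluster_subset_of_closed ends (E₀ \ s) z
          ⟨mem_openCluster_self _ _, fun _ => mem_openCluster_self _ _, fun h => absurd h hzW⟩ ?_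
        intro i hi a b he ha
        obtain ⟨haB, haO, haIn⟩ := ha
        have hiE : i ∈ E₀ := (Finset.mem_sdiff.mp hi).1
        have hins : i ∉ s := (Finset.mem_sdiff.mp hi).2
        have hbi : b ∈ ends i := by rw [he]; exact Sym2.mem_mk_right a b
        have hai : a ∈ ends i := by rw [he]; exact Sym2.mem_mk_left a b
        have hbB : b ∈ B := mem_openCluster_of_edge ends hi he haB
        refine ⟨hbB, fun hbW => ?_, fun hbW => ?_⟩
        · -- `b ∉ W`
          by_cases haW : a ∈ W
          · by_cases hbz : b = z
            · subst hbz; exact mem_openCluster_self _ _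
            · exact (hWa a haW i hiE b he (Or.inr hbB) hbz hbW).2
          · have hiI : i ∉ I := by
              intro hiI
              obtain ⟨-, w, hwW, hwi⟩ := memI.mp hiI
              rw [he, Sym2.mem_iff] at hwi
              rcases hwi with rfl | rfl
              · exact haW hwW
              · exact hbW hwW
            exact mem_openCluster_of_edge ends (Finset.mem_sdiff.mpr ⟨hi, hiI⟩) he (haO haW)
        · -- `b ∈ W`: the edge `i` meets `W`, so it is red after the flip; `a` is red-reachable after the flip
          have hiI : i ∈ I := memI.mpr ⟨hiE, b, hbW, hbi⟩
          have hi' : i ∈ s ∆ I := Finset.mem_symmDiff.mpr (Or.inr ⟨hiI, hins⟩)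
          have haR : a ∈ openCluster (ends '' (↑(s ∆ I) : Set ι)) z := by
            by_cases haW : a ∈ W
            · exact haIn haW
            · by_cases haz : a = z
              · subst haz; exact mem_openCluster_self _ _
              · exact hAI' (hWa b hbW i hiE a (he.trans Sym2.eq_swap) (Or.inr haB) haz haW).1
          exact mem_openCluster_of_edge ends hi' he haR
      exact ((hsub hyB).2.2) hyW

open Classical in
/-- The blue cluster of `z` after the attachment flip: `y ∈ C_z(E₀ \ (s ∆ I)) ↔ y = z ∨ (y ∈ C_z(E₀ \ s) ∧ y ∉ W) ∨ (y ∈ W ∧ y ∈ C_z(s))`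
(the attachment flip lemma for the complementary colouring; the attachment hypothesis is symmetric in the two colours).
[cite: KozmaNitzan2024, §5.5 (context only; folklore)] -/
theorem mem_openCluster_sdiff_flip_iff_attach (ends : ι → Sym2 V) {E₀ s : Finset ι} {z : V} (hs : s ⊆ E₀) (W : Set V)
    (hWU : ∀ w ∈ W, (w ∈ openCluster (ends '' (↑s : Set ι)) z ∨ w ∈ openCluster (ends '' (↑(E₀ \ s) : Set ι)) z) ∧ w ≠ z)
    (hWa : ∀ w ∈ W, ∀ i ∈ E₀, ∀ w', ends i = s(w, w') →
      (w' ∈ openCluster (ends '' (↑s : Set ι)) z ∨ w' ∈ openCluster (ends '' (↑(E₀ \ s) : Set ι)) z) → w' ≠ z → w' ∉ W →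
        w' ∈ openCluster (ends '' (↑(s \ E₀.filter (fun i => ∃ w, w ∈ W ∧ w ∈ ends i)) : Set ι)) z ∧
        w' ∈ openCluster (ends '' (↑((E₀ \ s) \ E₀.filter (fun i => ∃ w, w ∈ W ∧ w ∈ ends i)) : Set ι)) z)
    (y : V) :
    y ∈ openCluster (ends '' (↑(E₀ \ (s ∆ (E₀.filter (fun i => ∃ w, w ∈ W ∧ w ∈ ends i)))) : Set ι)) z ↔
      y = z ∨ (y ∈ openCluster (ends '' (↑(E₀ \ s) : Set ι)) z ∧ y ∉ W) ∨ (y ∈ W ∧ y ∈ openCluster (ends '' (↑s : Set ι)) z) := by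
  have hIE : E₀.filter (fun i => ∃ w, w ∈ W ∧ w ∈ ends i) ⊆ E₀ := Finset.filter_subset _ _
  rw [sdiff_symmDiff_eq E₀ s _ hIE]
  have hss : E₀ \ (E₀ \ s) = s := Finset.sdiff_sdiff_eq_self hs
  have h := mem_openCluster_flip_iff_attach ends (E₀ := E₀) (s := E₀ \ s) (z := z) Finset.sdiff_subset W
    (fun w hw => ⟨by rw [hss]; exact (hWU w hw).1.symm, (hWU w hw).2⟩)
    (fun w hw i hi w' he hw' hne hnW => by
      rw [hss] at hw' ⊢
      exact (hWa w hw i hi w' he hw'.symm hne hnW).symm) y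
  rw [hss] at h
  exact h

open Classical in
/-- **The zone is invariant under attachment flips.**  Under the hypotheses of the attachment flip lemma,
`C_z(s ∆ I) ∪ C_z(E₀ \ (s ∆ I)) = C_z(s) ∪ C_z(E₀ \ s)`; in particular the wall `x ∉ zone` is preserved. [cite: KozmaNitzan2024, §5.5 (context only)] -/
theorem union_flip_eq_attach (ends : ι → Sym2 V) {E₀ s : Finset ι} {z : V} (hs : s ⊆ E₀) (W : Set V)
    (hWU : ∀ w ∈ W, (w ∈ openCluster (ends '' (↑s : Set ι)) z ∨ w ∈ openCluster (ends '' (↑(E₀ \ s) : Set ι)) z) ∧ w ≠ z)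
    (hWa : ∀ w ∈ W, ∀ i ∈ E₀, ∀ w', ends i = s(w, w') →
      (w' ∈ openCluster (ends '' (↑s : Set ι)) z ∨ w' ∈ openCluster (ends '' (↑(E₀ \ s) : Set ι)) z) → w' ≠ z → w' ∉ W →
        w' ∈ openCluster (ends '' (↑(s \ E₀.filter (fun i => ∃ w, w ∈ W ∧ w ∈ ends i)) : Set ι)) z ∧
        w' ∈ openCluster (ends '' (↑((E₀ \ s) \ E₀.filter (fun i => ∃ w, w ∈ W ∧ w ∈ ends i)) : Set ι)) z) :
    openCluster (ends '' (↑(s ∆ (E₀.filter (fun i => ∃ w, w ∈ W ∧ w ∈ ends i))) : Set ι)) z ∪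
      openCluster (ends '' (↑(E₀ \ (s ∆ (E₀.filter (fun i => ∃ w, w ∈ W ∧ w ∈ ends i)))) : Set ι)) z =
    openCluster (ends '' (↑s : Set ι)) z ∪ openCluster (ends '' (↑(E₀ \ s) : Set ι)) z := by
  ext y
  simp only [Set.mem_union]
  rw [mem_openCluster_flip_iff_attach ends hs W hWU hWa y, mem_openCluster_sdiff_flip_iff_attach ends hs W hWU hWa y]
  constructor
  · rintro ((rfl | ⟨h, -⟩ | ⟨-, h⟩) | (rfl | ⟨h, -⟩ | ⟨-, h⟩))
    · exact Or.inl (mem_openCluster_self _ _)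
    · exact Or.inl h
    · exact Or.inr h
    · exact Or.inl (mem_openCluster_self _ _)
    · exact Or.inr h
    · exact Or.inl h
  · rintro (h | h)
    · by_cases hyW : y ∈ W
      · exact Or.inr (Or.inr (Or.inr ⟨hyW, h⟩))
      · exact Or.inl (Or.inr (Or.inl ⟨h, hyW⟩))
    · by_cases hyW : y ∈ W
      · exact Or.inl (Or.inr (Or.inr ⟨hyW, h⟩))
      · exact Or.inr (Or.inr (Or.inl ⟨h, hyW⟩))

open Classical in
/-- **The core is invariant under attachment flips.**  Under the hypotheses of the attachment flip lemma,
`C_z(s ∆ I) ∩ C_z(E₀ \ (s ∆ I)) = C_z(s) ∩ C_z(E₀ \ s)`: core vertices of `W` stay core vertices, one-sided vertices of `W` change side, and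
nothing changes outside `W` — so the attachment condition holds again after the flip and `s ↦ s ∆ I` is an involution.
[cite: KozmaNitzan2024, §5.5 (context only)] -/
theorem inter_flip_eq_attach (ends : ι → Sym2 V) {E₀ s : Finset ι} {z : V} (hs : s ⊆ E₀) (W : Set V)
    (hWU : ∀ w ∈ W, (w ∈ openCluster (ends '' (↑s : Set ι)) z ∨ w ∈ openCluster (ends '' (↑(E₀ \ s) : Set ι)) z) ∧ w ≠ z)
    (hWa : ∀ w ∈ W, ∀ i ∈ E₀, ∀ w', ends i = s(w, w') →
      (w' ∈ openCluster (ends '' (↑s : Set ι)) z ∨ w' ∈ openCluster (ends '' (↑(E₀ \ s) : Set ι)) z) → w' ≠ z → w' ∉ W →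
        w' ∈ openCluster (ends '' (↑(s \ E₀.filter (fun i => ∃ w, w ∈ W ∧ w ∈ ends i)) : Set ι)) z ∧
        w' ∈ openCluster (ends '' (↑((E₀ \ s) \ E₀.filter (fun i => ∃ w, w ∈ W ∧ w ∈ ends i)) : Set ι)) z) :
    openCluster (ends '' (↑(s ∆ (E₀.filter (fun i => ∃ w, w ∈ W ∧ w ∈ ends i))) : Set ι)) z ∩
      openCluster (ends '' (↑(E₀ \ (s ∆ (E₀.filter (fun i => ∃ w, w ∈ W ∧ w ∈ ends i)))) : Set ι)) z =
    openCluster (ends '' (↑s : Set ι)) z ∩ openCluster (ends '' (↑(E₀ \ s) : Set ι)) z := by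
  have hzW : z ∉ W := fun h => (hWU z h).2 rfl
  ext y
  simp only [Set.mem_inter_iff]
  rw [mem_openCluster_flip_iff_attach ends hs W hWU hWa y, mem_openCluster_sdiff_flip_iff_attach ends hs W hWU hWa y]
  constructor
  · rintro ⟨rfl | ⟨h₁, hyW⟩ | ⟨hyW, h₁⟩, h₂⟩
    · exact ⟨mem_openCluster_self _ _, mem_openCluster_self _ _⟩
    · rcases h₂ with rfl | ⟨h₂, -⟩ | ⟨hyW', -⟩
      · exact ⟨mem_openCluster_self _ _, mem_openCluster_self _ _⟩
      · exact ⟨h₁, h₂⟩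
      · exact absurd hyW' hyW
    · rcases h₂ with rfl | ⟨-, hyW'⟩ | ⟨-, h₂⟩
      · exact absurd hyW hzW
      · exact absurd hyW hyW'
      · exact ⟨h₂, h₁⟩
  · rintro ⟨h₁, h₂⟩
    by_cases hyW : y ∈ W
    · exact ⟨Or.inr (Or.inr ⟨hyW, h₂⟩), Or.inr (Or.inr ⟨hyW, h₁⟩)⟩
    · exact ⟨Or.inr (Or.inl ⟨h₁, hyW⟩), Or.inr (Or.inl ⟨h₂, hyW⟩)⟩

end Coefficientwise

end Summit.CriticalPhenomena.PercolationContinuityZ3.Theorems
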